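import Summits.QuantumFields.BalabanUV.Beta.GAN24.ExitFaceCurrentDescent
import Summits.QuantumFields.BalabanUV.Beta.GAN24.CoordinateProfileResponses

/-!
# `BalabanUV.Beta.GAN24.ExitFaceCurrentTowerStep` — binder row G-an2-4 ∕ (CONV-C), W-slot CT-W, conservation law (C)∕(C)sym AT ALL LEVELS, THE INDUCTION STEP OF THE (D)-TOWER of this
# lineage's note `HOME/b2b-balaban-gan24-formalise-leaf-04/g68/EXIT-FACE-CURRENT-TOWER.md` §5 (T5): **IF EVERY PROFILE-WEIGHTED TWO-LEG CURRENT OF THE LEVEL-`j` TABLE FAMILY `S` IS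
# FIRST-LEG DIVERGENCE-FREE, THEN SO IS EVERY PROFILE-WEIGHTED TWO-LEG CURRENT OF ITS CUBIC SECTOR `e3OfK Lc G_j S` ONE LEVEL UP** — profile weights = the hereditary class
# «constant + lattice gradient of a bounded single-coordinate function» on the slot direction `ν` and on the leg direction `β` (`CoordinateProfileResponses`); the step is
# `ExitFaceCurrentDescent.div_faceSlot_current_eq_zero_of_descent` with (ii) the class's zero multiplier response, (iii) its explicit same-class field response (the direction sums collapse to
# `κ″ = β`, `κ‴ = ν`), the ff-antisymmetry of the parity-odd `S` (free leg first), and a rescaling of the weights to `|·| ≤ 1`.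

NOT IN PRINT; OUR BOOKKEEPING ([folklore] bookkeeping BY NAME over this gen's `ExitFaceCurrentDescent` and `CoordinateProfileResponses`; G-an2-4 formalisation swarm, leaf prover
`b2b-balaban-gan24-formalise-leaf-04`, gen 68).  HONEST FRAMING (cell contract, verbatim): «discharging `BetaPertH` makes Bałaban's UV stability UNCONDITIONAL — a real constructive-QFT result;
it is NOT the continuum limit and NOT the Clay problem.»  HONEST DEPENDENCY (verbatim): «continuum YM on T⁴ ⇐ BetaPertH ∧ nine spine estimates (0/9 proved); BetaPertH ⇐ (D1) ∧ (D4) ∧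
CAP+tail; G-an2-4 gates asym, D1 and NE2/3/4.»

WHAT ([folklore]; generic `d`, `[NeZero Lc]`, in-block root `r ∈ box Lc`, every `j`, ANY local table family `S` with parity-odd rows `trK (S κ u) = −sgnK (S κ u)`; 0 `def`, 0 cited facts,
0 `def … : Prop`, 0 sorry): §1 `ff_swap` (`S κ u x z (inl a)(inl b) = −S κ u z x (inl b)(inl a)`), `tsum_profile_rescale` (`Σ'_x (c + dΦ(x_a))·f x = M·Σ'_x ((c + dΦ(x_a))/M)·f x`),
`sum_tsum_ite_dir` (a direction sum against `𝟙[κ = a]` collapses); §2 **`divFree_e3OfK_of_divFree`**: hypothesis = for all `c₁ Ψ₁ c₂ Ψ₂` (bounded `Ψ`'s) and all `v`,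
`Σ_κ′ (I(κ′,v) − I(κ′,v−e_κ′)) = 0`, `I(κ′,v) := Σ'_q (c₁ + dΨ₁(q_β))·Σ'_u (c₂ + dΨ₂(u_ν))·S ν u v q (inl κ′)(inl β)`; conclusion = for all `c Φ c′ Φ′` (bounded) and all `y`,
`Σ_μ (J(μ,y) − J(μ,y−e_μ)) = 0`, `J(μ,y) := Σ'_w (c + dΦ(w_β))·Σ'_t (c′ + dΦ′(t_ν))·e3OfK Lc G_j S ν t y w (inl μ)(inl β)`.  Asserts NO value of Bałaban's tables; discharges NOTHING of
(C)sym ∕ (Q-D) ∕ (Q-D-rate) ∕ «T2Shape» ∕ «T2Drift» ∕ (hW, hWall); NEVER «G-an2-4 closed» as (CONV-C); NOT D1, NOT `BetaPertH`, NOT continuum, NOT Clay.  2026-08-23; no existing file touched.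
-/

noncomputable section

open Finset
open scoped BigOperators
open Literature.MathematicalPhysics.QuantumFieldTheory
open Literature.MathematicalPhysics.QuantumFieldTheory.Balaban1983to89
open Literature.MathematicalPhysics.QuantumFieldTheory.Balaban1983to89.Beta
open ExpKernelCalculus (Site MKer)
open AffineAveraging (box toSite)
open B6BondElimination (unitVec)
open OneStepResolventKernel (Fib LocStencil)
open OneStepKernelFamily (KInvStep colH)
open Summit.QuantumFields.BalabanUV.Beta.TameKernelCalculus (trK trK_apply)
open Summit.QuantumFields.BalabanUV.Beta.BorderedHessian (stepScale sgnK sgnK_apply sgnF sgnF_inl)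
open Summit.QuantumFields.BalabanUV.Beta.AxialDressingRooted (coDressKBmAt)
open Summit.QuantumFields.BalabanUV.Beta.SpineRooted (e3OfK)
open Summit.QuantumFields.BalabanUV.Beta.GAN24.ExitFaceCurrentDescent (div_faceSlot_current_eq_zero_of_descent)
open Summit.QuantumFields.BalabanUV.Beta.GAN24.CoordinateProfileResponses (tsum_profile_mul_dressed_mm_eq_zero tsum_profile_mul_colH_eq_const_add_grad abs_Psi_le)

namespace Summit.QuantumFields.BalabanUV.Beta.GAN24.ExitFaceCurrentTowerStep

variable {d : ℕ} {Lc : ℕ} [NeZero Lc] {r : Fin (d + 1) → ℕ} {S : Fin (d + 1) → (Fin (d + 1) → ℤ) → MKer (d + 1) (Fib d)} {Cs δs : ℝ}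

/-! ## §1 Three bookkeeping lemmas -/

omit [NeZero Lc] in
/-- [folklore] The ff block of a parity-odd table is antisymmetric under the exchange of its two legs. -/
theorem ff_swap (hpar : ∀ κ u, trK (S κ u) = -sgnK (S κ u)) (κ : Fin (d + 1)) (u x z : Site (d + 1)) (a b : Fin (d + 1)) :
    S κ u x z (Sum.inl a) (Sum.inl b) = -S κ u z x (Sum.inl b) (Sum.inl a) := by
  have h := congrFun (congrFun (congrFun (congrFun (hpar κ u) z) x) (Sum.inl b)) (Sum.inl a)
  rw [trK_apply] at h
  rw [h]
  show (-sgnK (S κ u)) z x (Sum.inl b) (Sum.inl a) = -S κ u z x (Sum.inl b) (Sum.inl a)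
  simp only [Pi.neg_apply, sgnK_apply, sgnF_inl, one_mul]

omit [NeZero Lc] in
/-- [folklore] Rescaling a profile weight inside a `tsum`: `Σ'_x ρ x·f x = M·Σ'_x (ρ x / M)·f x` (`M ≠ 0`). -/
theorem tsum_rescale {ρ f : Site (d + 1) → ℝ} {M : ℝ} (hM : M ≠ 0) :
    ∑' x : Site (d + 1), ρ x * f x = M * ∑' x : Site (d + 1), ρ x / M * f x := by
  rw [← tsum_mul_left]
  exact tsum_congr fun x => by field_simp

omit [NeZero Lc] in
/-- [folklore] A direction sum against an indicator of one direction collapses: `Σ_κ Σ'_q (𝟙[κ = a]·h q)·Y κ q = Σ'_q h q·Y a q`. -/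
theorem sum_tsum_ite_dir (a : Fin (d + 1)) (h : Site (d + 1) → ℝ) (Y : Fin (d + 1) → Site (d + 1) → ℝ) :
    ∑ κ : Fin (d + 1), ∑' q : Site (d + 1), (if κ = a then h q else 0) * Y κ q = ∑' q : Site (d + 1), h q * Y a q := by
  rw [Finset.sum_eq_single a (fun κ _ hκ => by simp only [if_neg hκ, zero_mul, tsum_zero]) (fun ha => absurd (Finset.mem_univ a) ha)]
  simp only [if_true]

/-! ## §2 The induction step -/

-- heartbeats: this proof elaborates at ≈ 150–180 k (measured by leaf-04 g70 with a global ceiling on the concat cert: fails at 150 000, passes at 180 000);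
-- the ceiling is doubled so that the hub's `lake build` (which broke `ValueHessianLinearGauge` at the default on 2026-08-24) cannot stall the chain. No statement change.
set_option maxHeartbeats 400000 in
/-- [folklore] **THE (D)-TOWER INDUCTION STEP**: first-leg divergence-freeness of all profile-weighted two-leg currents passes from the level-`j` table family `S` to its cubic sector
`e3OfK Lc G_j S` (profile class «constant + lattice gradient of a bounded single-coordinate function» on the slot direction `ν` and the leg direction `β`). -/
theorem divFree_e3OfK_of_divFree (hr : r ∈ box (d + 1) Lc) (j : ℕ) (hS : LocStencil S Cs δs) (hδs : 0 < δs) (hpar : ∀ κ u, trK (S κ u) = -sgnK (S κ u)) (ν β : Fin (d + 1))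
    (hyp : ∀ (c₁ : ℝ) (Ψ₁ : ℤ → ℝ) (B₁ : ℝ), (∀ s, |Ψ₁ s| ≤ B₁) → ∀ (c₂ : ℝ) (Ψ₂ : ℤ → ℝ) (B₂ : ℝ), (∀ s, |Ψ₂ s| ≤ B₂) → ∀ v : Site (d + 1),
      ∑ κ' : Fin (d + 1),
        ((∑' q : Site (d + 1), (c₁ + (Ψ₁ (q β + 1) - Ψ₁ (q β))) * ∑' u : Site (d + 1), (c₂ + (Ψ₂ (u ν + 1) - Ψ₂ (u ν))) * S ν u v q (Sum.inl κ') (Sum.inl β))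
          - ∑' q : Site (d + 1), (c₁ + (Ψ₁ (q β + 1) - Ψ₁ (q β))) * ∑' u : Site (d + 1), (c₂ + (Ψ₂ (u ν + 1) - Ψ₂ (u ν))) * S ν u (v - unitVec κ') q (Sum.inl κ') (Sum.inl β)) = 0)
    (c : ℝ) (Φ : ℤ → ℝ) {B : ℝ} (hΦ : ∀ s, |Φ s| ≤ B) (c' : ℝ) (Φ' : ℤ → ℝ) {B' : ℝ} (hΦ' : ∀ s, |Φ' s| ≤ B') (y : Site (d + 1)) :
    ∑ μ : Fin (d + 1),
      ((∑' w : Site (d + 1), (c + (Φ (w β + 1) - Φ (w β))) * ∑' t : Site (d + 1), (c' + (Φ' (t ν + 1) - Φ' (t ν))) *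
          e3OfK Lc (coDressKBmAt (toSite r) Lc (KInvStep (d := d) Lc j)) S ν t y w (Sum.inl μ) (Sum.inl β))
        - ∑' w : Site (d + 1), (c + (Φ (w β + 1) - Φ (w β))) * ∑' t : Site (d + 1), (c' + (Φ' (t ν + 1) - Φ' (t ν))) *
          e3OfK Lc (coDressKBmAt (toSite r) Lc (KInvStep (d := d) Lc j)) S ν t (y - unitVec μ) w (Sum.inl μ) (Sum.inl β)) = 0 := by
  classical
  have hB : 0 ≤ B := (abs_nonneg _).trans (hΦ 0)
  have hB' : 0 ≤ B' := (abs_nonneg _).trans (hΦ' 0)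
  -- rescaled weights with `|·| ≤ 1`
  set Mρ : ℝ := |c| + (B + B) + 1 with hMρ
  set Mσ : ℝ := |c'| + (B' + B') + 1 with hMσ
  have hMρ0 : 0 < Mρ := by positivity
  have hMσ0 : 0 < Mσ := by positivity
  set ρ₁ : Site (d + 1) → ℝ := fun w => (c + (Φ (w β + 1) - Φ (w β))) / Mρ with hρ₁
  set σ₁ : Site (d + 1) → ℝ := fun t => (c' + (Φ' (t ν + 1) - Φ' (t ν))) / Mσ with hσ₁
  have hρb : ∀ w, |ρ₁ w| ≤ 1 := by
    intro w
    rw [hρ₁, abs_div, abs_of_pos hMρ0, div_le_one hMρ0]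
    refine (abs_add_le _ _).trans ?_
    have := (abs_sub (Φ (w β + 1)) (Φ (w β))).trans (add_le_add (hΦ _) (hΦ _))
    linarith
  have hσb : ∀ t, |σ₁ t| ≤ 1 := by
    intro t
    rw [hσ₁, abs_div, abs_of_pos hMσ0, div_le_one hMσ0]
    refine (abs_add_le _ _).trans ?_
    have := (abs_sub (Φ' (t ν + 1)) (Φ' (t ν))).trans (add_le_add (hΦ' _) (hΦ' _))
    linarith
  -- (ii) zero multiplier response of the rescaled leg datum
  have hM : ∀ (m : Fin (d + 1)) (q : Site (d + 1)),
      ∑' w : Site (d + 1), ρ₁ w * coDressKBmAt (toSite r) Lc (KInvStep (d := d) Lc j) q ((Lc : ℤ) • w) (Sum.inr m) (Sum.inr β) = 0 := by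
    intro m q
    have h := tsum_profile_mul_dressed_mm_eq_zero (d := d) hr j β m c Φ hΦ q
    rw [tsum_rescale (M := Mρ) hMρ0.ne'] at h
    simpa [hρ₁, hMρ0.ne'] using h
  -- (iii) the responses of the rescaled data, explicitly (same class one level down)
  set A₁ : ℝ := c * ((Lc : ℝ) * ((((Lc ^ (j + 1) : ℕ) : ℝ)) ^ (d + 1 + 1))⁻¹) with hA₁
  set A₂ : ℝ := c' * ((Lc : ℝ) * ((((Lc ^ (j + 1) : ℕ) : ℝ)) ^ (d + 1 + 1))⁻¹) with hA₂
  set cH : ℝ := (stepScale d Lc j * (Lc : ℝ) ^ (d + 1))⁻¹ with hcH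
  set Ψ₁ : ℤ → ℝ := fun n => (-(A₁ * (Lc : ℝ)⁻¹) * (((n % (Lc : ℤ) : ℤ) : ℝ)) + cH * Φ (n / (Lc : ℤ))) / Mρ with hΨ₁
  set Ψ₂ : ℤ → ℝ := fun n => (-(A₂ * (Lc : ℝ)⁻¹) * (((n % (Lc : ℤ) : ℤ) : ℝ)) + cH * Φ' (n / (Lc : ℤ))) / Mσ with hΨ₂
  have hΨ₁b : ∀ s, |Ψ₁ s| ≤ (|A₁| + |cH| * B) / Mρ := fun s => by
    rw [hΨ₁, abs_div, abs_of_pos hMρ0]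
    exact div_le_div_of_nonneg_right (abs_Psi_le (Lc := Lc) A₁ cH Φ hΦ s) hMρ0.le
  have hΨ₂b : ∀ s, |Ψ₂ s| ≤ (|A₂| + |cH| * B') / Mσ := fun s => by
    rw [hΨ₂, abs_div, abs_of_pos hMσ0]
    exact div_le_div_of_nonneg_right (abs_Psi_le (Lc := Lc) A₂ cH Φ' hΦ' s) hMσ0.le
  have eH : ∀ (κ'' : Fin (d + 1)) (q : Site (d + 1)),
      ∑' w : Site (d + 1), ρ₁ w * colH (coDressKBmAt (toSite r) Lc (KInvStep (d := d) Lc j)) Lc β w κ'' q =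
        if κ'' = β then A₁ * (Lc : ℝ)⁻¹ / Mρ + (Ψ₁ (q β + 1) - Ψ₁ (q β)) else 0 := by
    intro κ'' q
    have h := tsum_profile_mul_colH_eq_const_add_grad (d := d) hr j β κ'' c Φ hΦ q
    rw [tsum_rescale (M := Mρ) hMρ0.ne'] at h
    have h' : ∑' w : Site (d + 1), ρ₁ w * colH (coDressKBmAt (toSite r) Lc (KInvStep (d := d) Lc j)) Lc β w κ'' q =
        (if κ'' = β then
          (c * ((Lc : ℝ) * ((((Lc ^ (j + 1) : ℕ) : ℝ)) ^ (d + 1 + 1))⁻¹)) * (Lc : ℝ)⁻¹ +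
            ((-((c * ((Lc : ℝ) * ((((Lc ^ (j + 1) : ℕ) : ℝ)) ^ (d + 1 + 1))⁻¹)) * (Lc : ℝ)⁻¹) * ((((q β + 1) % (Lc : ℤ) : ℤ) : ℝ))
                + (stepScale d Lc j * (Lc : ℝ) ^ (d + 1))⁻¹ * Φ ((q β + 1) / (Lc : ℤ)))
              - (-((c * ((Lc : ℝ) * ((((Lc ^ (j + 1) : ℕ) : ℝ)) ^ (d + 1 + 1))⁻¹)) * (Lc : ℝ)⁻¹) * (((q β % (Lc : ℤ) : ℤ) : ℝ))
                + (stepScale d Lc j * (Lc : ℝ) ^ (d + 1))⁻¹ * Φ (q β / (Lc : ℤ))))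
        else 0) / Mρ := by
      rw [← h, mul_div_cancel_left₀ _ hMρ0.ne']
    rw [h']
    split_ifs
    · simp only [hΨ₁, hA₁, hcH]
      field_simp
    · simp
  have eσ : ∀ (κ''' : Fin (d + 1)) (u : Site (d + 1)),
      ∑' t : Site (d + 1), σ₁ t * colH (coDressKBmAt (toSite r) Lc (KInvStep (d := d) Lc j)) Lc ν t κ''' u =
        if κ''' = ν then A₂ * (Lc : ℝ)⁻¹ / Mσ + (Ψ₂ (u ν + 1) - Ψ₂ (u ν)) else 0 := by
    intro κ''' u
    have h := tsum_profile_mul_colH_eq_const_add_grad (d := d) hr j ν κ''' c' Φ' hΦ' u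
    rw [tsum_rescale (M := Mσ) hMσ0.ne'] at h
    have h' : ∑' t : Site (d + 1), σ₁ t * colH (coDressKBmAt (toSite r) Lc (KInvStep (d := d) Lc j)) Lc ν t κ''' u =
        (if κ''' = ν then
          (c' * ((Lc : ℝ) * ((((Lc ^ (j + 1) : ℕ) : ℝ)) ^ (d + 1 + 1))⁻¹)) * (Lc : ℝ)⁻¹ +
            ((-((c' * ((Lc : ℝ) * ((((Lc ^ (j + 1) : ℕ) : ℝ)) ^ (d + 1 + 1))⁻¹)) * (Lc : ℝ)⁻¹) * ((((u ν + 1) % (Lc : ℤ) : ℤ) : ℝ))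
                + (stepScale d Lc j * (Lc : ℝ) ^ (d + 1))⁻¹ * Φ' ((u ν + 1) / (Lc : ℤ)))
              - (-((c' * ((Lc : ℝ) * ((((Lc ^ (j + 1) : ℕ) : ℝ)) ^ (d + 1 + 1))⁻¹)) * (Lc : ℝ)⁻¹) * (((u ν % (Lc : ℤ) : ℤ) : ℝ))
                + (stepScale d Lc j * (Lc : ℝ) ^ (d + 1))⁻¹ * Φ' (u ν / (Lc : ℤ))))
        else 0) / Mσ := by
      rw [← h, mul_div_cancel_left₀ _ hMσ0.ne']
    rw [h']
    split_ifs
    · simp only [hΨ₂, hA₂, hcH]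
      field_simp
    · simp
  -- the level-j current of the descent, collapsed and flipped: it is MINUS a profile-weighted current of `S` with the free leg first
  have eT : ∀ (v : Site (d + 1)) (κ' : Fin (d + 1)),
      ∑ κ'' : Fin (d + 1), ∑' q : Site (d + 1), (∑' w : Site (d + 1), ρ₁ w * colH (coDressKBmAt (toSite r) Lc (KInvStep (d := d) Lc j)) Lc β w κ'' q) *
          ∑ κ''' : Fin (d + 1), ∑' u : Site (d + 1), (∑' t : Site (d + 1), σ₁ t * colH (coDressKBmAt (toSite r) Lc (KInvStep (d := d) Lc j)) Lc ν t κ''' u) *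
            S κ''' u q v (Sum.inl κ'') (Sum.inl κ') =
      -(∑' q : Site (d + 1), (A₁ * (Lc : ℝ)⁻¹ / Mρ + (Ψ₁ (q β + 1) - Ψ₁ (q β))) *
          ∑' u : Site (d + 1), (A₂ * (Lc : ℝ)⁻¹ / Mσ + (Ψ₂ (u ν + 1) - Ψ₂ (u ν))) * S ν u v q (Sum.inl κ') (Sum.inl β)) := by
    intro v κ'
    simp only [eH, eσ]
    rw [sum_tsum_ite_dir β (fun q => A₁ * (Lc : ℝ)⁻¹ / Mρ + (Ψ₁ (q β + 1) - Ψ₁ (q β)))]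
    rw [← tsum_neg]
    refine tsum_congr fun q => ?_
    rw [sum_tsum_ite_dir ν (fun u => A₂ * (Lc : ℝ)⁻¹ / Mσ + (Ψ₂ (u ν + 1) - Ψ₂ (u ν))), ← mul_neg, ← tsum_neg]
    congr 1
    exact tsum_congr fun u => by rw [ff_swap hpar ν u q v β κ', mul_neg]
  -- the descent with the rescaled data
  have key := div_faceSlot_current_eq_zero_of_descent (d := d) hr j hS hδs hpar hσb hρb ν β hM y (fun r' _ => by
    have h := hyp (A₁ * (Lc : ℝ)⁻¹ / Mρ) Ψ₁ _ hΨ₁b (A₂ * (Lc : ℝ)⁻¹ / Mσ) Ψ₂ _ hΨ₂b ((Lc : ℤ) • y + toSite r')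
    simp only [eT, neg_sub_neg]
    rw [← neg_eq_zero, ← Finset.sum_neg_distrib]
    simpa only [neg_sub] using h)
  -- undo the rescaling
  have e : ∀ (μ : Fin (d + 1)) (z : Site (d + 1)),
      ∑' w : Site (d + 1), (c + (Φ (w β + 1) - Φ (w β))) * ∑' t : Site (d + 1), (c' + (Φ' (t ν + 1) - Φ' (t ν))) *
          e3OfK Lc (coDressKBmAt (toSite r) Lc (KInvStep (d := d) Lc j)) S ν t z w (Sum.inl μ) (Sum.inl β) =
      Mρ * (Mσ * ∑' w : Site (d + 1), ρ₁ w * ∑' t : Site (d + 1), σ₁ t * e3OfK Lc (coDressKBmAt (toSite r) Lc (KInvStep (d := d) Lc j)) S ν t z w (Sum.inl μ) (Sum.inl β)) := by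
    intro μ z
    have e1 : ∀ w : Site (d + 1), (c + (Φ (w β + 1) - Φ (w β))) = Mρ * ρ₁ w := fun w => by simp only [hρ₁]; field_simp
    have e2 : ∀ t : Site (d + 1), (c' + (Φ' (t ν + 1) - Φ' (t ν))) = Mσ * σ₁ t := fun t => by simp only [hσ₁]; field_simp
    have e3 : ∀ w : Site (d + 1), ∑' t : Site (d + 1), (c' + (Φ' (t ν + 1) - Φ' (t ν))) *
        e3OfK Lc (coDressKBmAt (toSite r) Lc (KInvStep (d := d) Lc j)) S ν t z w (Sum.inl μ) (Sum.inl β) =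
        Mσ * ∑' t : Site (d + 1), σ₁ t * e3OfK Lc (coDressKBmAt (toSite r) Lc (KInvStep (d := d) Lc j)) S ν t z w (Sum.inl μ) (Sum.inl β) := by
      intro w
      rw [← tsum_mul_left]
      exact tsum_congr fun t => by rw [e2 t, mul_assoc]
    calc _ = ∑' w : Site (d + 1), Mρ * (Mσ * (ρ₁ w * ∑' t : Site (d + 1), σ₁ t *
          e3OfK Lc (coDressKBmAt (toSite r) Lc (KInvStep (d := d) Lc j)) S ν t z w (Sum.inl μ) (Sum.inl β))) :=
          tsum_congr fun w => by rw [e3 w, e1 w]; ring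
      _ = _ := by rw [tsum_mul_left, tsum_mul_left]
  simp only [e, ← mul_sub, ← Finset.mul_sum, key, mul_zero]

end Summit.QuantumFields.BalabanUV.Beta.GAN24.ExitFaceCurrentTowerStep
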